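import Mathlib
import Summits.NavierStokesRegularity.NavierStokesRegularity.Theorems.EulerZoomLiouvillePowerGaugeEulerLiouvilleSelfSimilarBernoulliSqueezeFree
import Summits.NavierStokesRegularity.NavierStokesRegularity.Theorems.EulerZoomLiouvillePowerGaugeEulerLiouvilleSelfSimilarBernoulliSqueezePinchedMember
import HarnessLib

/-!
# «FAST VORTICAL CHANNELS SQUEEZE VOLUME TOO FAST», members with the ONE-SIDED CHANNEL ONLY: NO GROWTH HYPOTHESIS, NO UPPER RATE, NO PRESSURE CLAUSE,
# threshold `1/((2+ρ)(1+ρ))` (crux `EulerZoomLiouville.PowerGaugeEulerLiouville` = stmt-NavierStokesRegularity-19832, line `birth`, THE ONE STATEMENT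
# `stub_selfSimilarC2Needle` and the past stratum `IsPastSelfSimilarClassical`; LEAD's RESIDUE-MEMO-19832-g12 target T3)

Route №10 `EulerZoomLiouville` (NavierStokesRegularity); width seat ns-ezl-w5 g2.  Assembly of the growth-free Sobolev thinness
(`Loc.volume_bernoulliHigh_inter_far_le_sobolev_free`, p642936) and the growth-free squeeze core (`Loc.curl_eq_zero_of_vorticalFastChannel_of_thin_free`,
`…SqueezeFree`): the members below have EXACTLY the hypotheses of the LEAD's `Loc.selfSimilar_ae_eq_zero_of_vorticalFastChannelC2_profile_sharp` (p639458) and of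
this seat's past twin `Past.selfSimilar_ae_eq_zero_of_vorticalFastChannelC2_profile_sharp_past` (p640502) WITH THE LINEAR-GROWTH BINDER `hK₁` DELETED.

* `Past.profile_eq_zero_of_vorticalFastChannelC2_free` / **`Past.selfSimilar_ae_eq_zero_of_vorticalFastChannelC2_profile_free_past`** — past-exact about
  `(T, x₀)` for `τ < T₁` (`T₁ ≤ 0`, `T₁ ≤ T`), `V ∈ C²`, for every classical pressure `P′` and level `h` a radius beyond which every VORTICAL point of `{ℋ_{P′} > h}`
  has `⟪y, γy + V y⟫ ≤ −c₁‖y‖²`, ONE `c₁ > 1/((2+ρ)(1+ρ))` ⇒ trivial.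
* **`Loc.selfSimilar_ae_eq_zero_of_vorticalFastChannelC2_profile_free`** — the origin-centred member (past one at `T = T₁ = 0`, `x₀ = 0`).

For the skeleton (LEAD): in `HasFastVorticalChannel ρ V` (v61) the conjunct `(∃ K₁, ∀ y, ‖V y‖ ≤ K₁ * (1 + ‖y‖))` can be DELETED (filler
`Loc.selfSimilar_ae_eq_zero_of_vorticalFastChannelC2_profile_free`, same remaining arguments; past disjunct via `…_free_past`).  THE ONE STATEMENT's (N3) residue =
«for every `c₁ > 1/((2+ρ)(1+ρ))`, some classical pressure and level with SLOW vortical Bernoulli-high points (`s − γ < c₁`: tangential or pressurised) beyond every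
radius» — super-linear growth and radial super-inflow spikes no longer escape.
HONEST LABEL: PARTIAL model-class stratum.  WHAT THIS IS NOT: not NS, not E — 19832 is a crux CLASS on the MODEL lattice (E/NS strata) and stays OPEN; NS regularity
is NOT proved. [folklore; ConstantinIgnatovaVicol2026Putative §3.4; Gagliardo–Nirenberg–Sobolev inequality]
-/

noncomputable section

-- flat `Theorems/<Route><Decl>…` files of one crux share the namespace of the crux (tree convention)
set_option linter.dupNamespace false

open MeasureTheory Set Filter Topology Metric Function InnerProductSpace TopologicalSpace
open scoped RealInnerProductSpace NNReal ENNReal ContDiff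

namespace Summit.NavierStokesRegularity.NavierStokesRegularity.Theorems.PowerGaugeEulerLiouville

open Literature.Analysis Literature.Analysis.FluidPDE Literature.Analysis.FunctionSpaces

/-! ### The past-exact / shifted member, one-sided channel, no growth -/

namespace Past

variable {ρ T T₁ : ℝ} {x₀ : EuclideanSpace ℝ (Fin 3)}
  {u : ℝ → EuclideanSpace ℝ (Fin 3) → EuclideanSpace ℝ (Fin 3)} {p : ℝ → EuclideanSpace ℝ (Fin 3) → ℝ}
  {H : ℝ → EuclideanSpace ℝ (Fin 3) → EuclideanSpace ℝ (Fin 3) →L[ℝ] EuclideanSpace ℝ (Fin 3)} {c : ℝ≥0}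
  {V : EuclideanSpace ℝ (Fin 3) → EuclideanSpace ℝ (Fin 3)} {P : EuclideanSpace ℝ (Fin 3) → ℝ}

/-- **Past-exact member, `C²` profile with a far vortical channel (ONE-SIDED rate `c₁ > 1/((2+ρ)(1+ρ))`) for every classical pressure: the profile is ZERO**
(`0 < ρ ≤ ½`; exact self-similarity about `(T, x₀)` for `τ < T₁ ≤ min 0 T`; NO growth hypothesis, NO upper rate, NO pressure clause). [folklore; GNS inequality] -/
theorem profile_eq_zero_of_vorticalFastChannelC2_free (hρ : 0 < ρ) (hρh : ρ ≤ 1 / 2) (hT₁ : T₁ ≤ 0) (hTT₁ : T₁ ≤ T)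
    (hsol : IsDistributionalNSSolutionOn (slab (EuclideanSpace ℝ (Fin 3)) (Iio 0) isOpen_Iio) 0 0 u p)
    (hH : HasWeakSpatialGradientOn (slab (EuclideanSpace ℝ (Fin 3)) (Iio 0) isOpen_Iio) u H)
    (hA : ∀ a : ℝ, 0 < a → ENNReal.ofReal (a ^ (2 * ρ)) *
      cknA a (0 : ℝ × EuclideanSpace ℝ (Fin 3)) u ≤ (c : ℝ≥0∞))
    (hE : ∀ a : ℝ, 0 < a → ENNReal.ofReal (a ^ ρ) *
      cknE a (0 : ℝ × EuclideanSpace ℝ (Fin 3)) H ≤ (c : ℝ≥0∞))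
    (hD : ∀ a : ℝ, 0 < a → ENNReal.ofReal (a ^ (2 * ρ)) *
      cknD a (0 : ℝ × EuclideanSpace ℝ (Fin 3)) p ≤ (c : ℝ≥0∞))
    (hu : ∀ τ : ℝ, τ < T₁ → u τ = fun x => selfSimilarCollapse (1 / (2 + ρ)) T V τ (x - x₀))
    (hp : ∀ τ : ℝ, τ < T₁ → p τ = fun x => selfSimilarCollapsePressure (1 / (2 + ρ)) T P τ (x - x₀))
    (hV : ContDiff ℝ 2 V) {c₁ : ℝ} (hc₁ : 1 / ((2 + ρ) * (1 + ρ)) < c₁)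
    (hB : ∀ P' : EuclideanSpace ℝ (Fin 3) → ℝ, IsSelfSimilarEulerProfile (1 / (2 + ρ)) 0 V P' →
      ∀ h : ℝ, ∃ R₀ : ℝ, ∀ y : EuclideanSpace ℝ (Fin 3), R₀ ≤ ‖y‖ →
        h < selfSimilarBernoulli (1 / (2 + ρ)) 0 V P' y → curl V y ≠ 0 →
          ⟪y, selfSimilarTransport (1 / (2 + ρ)) 0 V y⟫ ≤ -(c₁ * ‖y‖ ^ 2)) : V = 0 := by
  -- adapted from `Past.profile_eq_zero_of_pinchedVorticalChannelC2` (…SqueezePinchedMember, this seat)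
  have hρ1' : ρ < 1 := by linarith
  have h2ρ : (0 : ℝ) < 2 + ρ := by linarith
  have hγ : (0 : ℝ) < 1 / (2 + ρ) := one_div_pos.2 h2ρ
  have hγ2 : 1 / (2 + ρ) < 1 / 2 := one_div_lt_one_div_of_lt two_pos (by linarith)
  -- the far-past extension and its dictionary
  have hext := Shifted.isDistributional_selfSimilarCollapse_of_past hT₁ hTT₁ x₀ hsol hu hp
  have hpmE : AEStronglyMeasurable (uncurry (selfSimilarCollapsePressure (1 / (2 + ρ)) 0 P))
      (volume.restrict (Iio (0 : ℝ) ×ˢ (univ : Set (EuclideanSpace ℝ (Fin 3))))) := by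
    have := hext.2.2.1.aestronglyMeasurable
    simpa [slab] using this
  have hPm : AEStronglyMeasurable P volume :=
    aestronglyMeasurable_pressureProfile (p := selfSimilarCollapsePressure (1 / (2 + ρ)) 0 P) hpmE fun _ _ => rfl
  have hP1 : LocallyIntegrable P volume :=
    Shifted.locallyIntegrable_pressureProfile_of_slab hγ.le (by linarith) hPm hext.2.2.1
  obtain ⟨P', hprof⟩ := exists_isSelfSimilarEulerProfile hρ hT₁ hTT₁ hsol hu hp hV
  have hfast := hB P' hprof
  -- the bridge on the extension: `P = P' + c₀` a.e.
  obtain ⟨c₀, hc₀⟩ := WeakToClassical.pressureProfile_ae_eq_add_const hext (fun _ _ => rfl) (fun _ _ => rfl) hV hP1 hprof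
  -- `A`-growth of the profile: large scales from the gauge, then all scales (continuity), real constant
  obtain ⟨CA, hCA, hgrowth⟩ := Shifted.profile_energy_growth_of_gaugeA_past hρ hρh hT₁ hTT₁ x₀ hu hA
  obtain ⟨cA, hcA, hA'⟩ := Loc.real_growth_of_growth_le hV.continuous (θ := 1 - 2 * ρ) (by linarith)
    (L₀ := 2 - T₁) (by linarith) hCA hgrowth
  -- `E`-growth of the profile gradient (ns-ezl-w2 g3), then all scales
  have hV1 : ContDiff ℝ 1 V := hV.of_le (by norm_num)
  obtain ⟨CE, hCE, hEgr⟩ := NeedleRace.lintegral_fderiv_sq_ball_le_of_past hρ hρ1' hT₁ hTT₁ x₀ hH hu hE hV1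
  obtain ⟨cE, hcE, hE'⟩ := Loc.real_growth_of_growth_le (hV1.continuous_fderiv one_ne_zero) (θ := 1 - ρ) (by linarith)
    (L₀ := 2 - T₁) (by linarith) hCE hEgr
  -- `D`-growth of the member's pressure profile
  have hpm : AEStronglyMeasurable (uncurry p)
      (volume.restrict (Iio (0 : ℝ) ×ˢ (univ : Set (EuclideanSpace ℝ (Fin 3))))) := by
    have := hsol.2.2.1.aestronglyMeasurable
    simpa [slab] using this
  obtain ⟨CD, hCD, hDgrowth⟩ := profile_pressure_growth_of_gaugeD_past hρ hρ1' hT₁ hTT₁ x₀ hpm hp hD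
  have hD' : ∀ L : ℝ, 2 - T₁ ≤ L → ∫⁻ y in ball (0 : EuclideanSpace ℝ (Fin 3)) L, ‖P y‖ₑ ^ (3 / 2 : ℝ) ≤
      (CD.toNNReal : ℝ≥0∞) * ENNReal.ofReal (L ^ (2 - 2 * ρ)) := by
    intro L hL; rw [ENNReal.coe_toNNReal hCD]; exact hDgrowth L hL
  -- GROWTH-FREE SOBOLEV THINNESS of the high sets of `ℋ_{P'}`, rate `3 + 3ρ`
  have hthin : ∀ h : ℝ, ∃ C R₂ : ℝ, 0 < R₂ ∧ ∀ R : ℝ, R₂ ≤ R →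
      volume ({y : EuclideanSpace ℝ (Fin 3) | h < selfSimilarBernoulli (1 / (2 + ρ)) 0 V P' y} ∩ {y | R ≤ ‖y‖}) ≤
        ENNReal.ofReal (C * R ^ (-(3 + 3 * ρ))) := fun h =>
    Loc.volume_bernoulliHigh_inter_far_le_sobolev_free hρ hprof hcA hcE hA' hE' hPm hD' hc₀ h
  -- the race `3γ < c₁ (3 + 3ρ)`, i.e. `1 < c₁ (2+ρ)(1+ρ)`
  have hrace : 3 * (1 / (2 + ρ)) < c₁ * (3 + 3 * ρ) := by
    have h1ρ : (0 : ℝ) < 1 + ρ := by linarith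
    have h1 := (div_lt_iff₀ (by positivity : (0 : ℝ) < (2 + ρ) * (1 + ρ))).1 hc₁
    rw [show 3 * (1 / (2 + ρ)) = 3 / (2 + ρ) by ring, div_lt_iff₀ h2ρ]
    nlinarith
  have hc₁0 : 0 < c₁ := lt_trans (by positivity) hc₁
  have hm : (0 : ℝ) < 3 + 3 * ρ := by linarith
  have hcurl : ∀ x, curl V x = 0 := fun x =>
    Loc.curl_eq_zero_of_vorticalFastChannel_of_thin_free hprof hγ hγ2 (by linarith : 1 - 2 * ρ < 2) hA' hm hc₁0 hrace hthin hfast x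
  exact profile_eq_zero_of_irrotationalC2 hρ hρh hT₁ hTT₁ hsol hA hu hp hV hcurl

/-- **PAST-EXACT MEMBER WHOSE `C²` PROFILE HAS A FAR VORTICAL BERNOULLI CHANNEL (ONE-SIDED, `c₁ > 1/((2+ρ)(1+ρ))`) IS TRIVIAL — NO GROWTH HYPOTHESIS, NO UPPER
RATE, NO PRESSURE CLAUSE** (crux hypotheses verbatim, `0 < ρ ≤ ½`, exact self-similarity about `(T, x₀)` for `τ < T₁`, `T₁ ≤ 0`, `T₁ ≤ T`; `V ∈ C²`; for every classical
pressure `P′` of `V` and every level `h` a radius beyond which every VORTICAL point of `{ℋ_{P′} > h}` has `⟪y, γy + V y⟫ ≤ −c₁‖y‖²`).  = p640502's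
`Past.selfSimilar_ae_eq_zero_of_vorticalFastChannelC2_profile_sharp_past` with the binder `hK₁` DELETED. [folklore; GNS inequality] -/
theorem selfSimilar_ae_eq_zero_of_vorticalFastChannelC2_profile_free_past (hρ : 0 < ρ) (hρh : ρ ≤ 1 / 2) (hT₁ : T₁ ≤ 0)
    (hTT₁ : T₁ ≤ T) (x₀ : EuclideanSpace ℝ (Fin 3))
    (hsw : IsSuitableWeakSolutionOn (slab (EuclideanSpace ℝ (Fin 3)) (Iio 0) isOpen_Iio) 0 0 u p)
    (hH : HasWeakSpatialGradientOn (slab (EuclideanSpace ℝ (Fin 3)) (Iio 0) isOpen_Iio) u H)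
    (hgauge : ∀ a : ℝ, 0 < a →
      ENNReal.ofReal (a ^ (2 * ρ)) * cknA a (0 : ℝ × EuclideanSpace ℝ (Fin 3)) u +
          ENNReal.ofReal (a ^ ρ) * cknE a (0 : ℝ × EuclideanSpace ℝ (Fin 3)) H +
        ENNReal.ofReal (a ^ (2 * ρ)) * cknD a (0 : ℝ × EuclideanSpace ℝ (Fin 3)) p ≤ (c : ℝ≥0∞))
    (hu : ∀ τ : ℝ, τ < T₁ → u τ = fun x => selfSimilarCollapse (1 / (2 + ρ)) T V τ (x - x₀))
    (hp : ∀ τ : ℝ, τ < T₁ → p τ = fun x => selfSimilarCollapsePressure (1 / (2 + ρ)) T P τ (x - x₀))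
    (hV : ContDiff ℝ 2 V) {c₁ : ℝ} (hc₁ : 1 / ((2 + ρ) * (1 + ρ)) < c₁)
    (hB : ∀ P' : EuclideanSpace ℝ (Fin 3) → ℝ, IsSelfSimilarEulerProfile (1 / (2 + ρ)) 0 V P' →
      ∀ h : ℝ, ∃ R₀ : ℝ, ∀ y : EuclideanSpace ℝ (Fin 3), R₀ ≤ ‖y‖ →
        h < selfSimilarBernoulli (1 / (2 + ρ)) 0 V P' y → curl V y ≠ 0 →
          ⟪y, selfSimilarTransport (1 / (2 + ρ)) 0 V y⟫ ≤ -(c₁ * ‖y‖ ^ 2)) :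
    uncurry u =ᵐ[volume.restrict (Iio (0 : ℝ) ×ˢ (univ : Set (EuclideanSpace ℝ (Fin 3))))] 0 :=
  have hA : ∀ a : ℝ, 0 < a → ENNReal.ofReal (a ^ (2 * ρ)) *
      cknA a (0 : ℝ × EuclideanSpace ℝ (Fin 3)) u ≤ (c : ℝ≥0∞) :=
    fun a ha => le_trans (le_trans le_self_add le_self_add) (hgauge a ha)
  have hE : ∀ a : ℝ, 0 < a → ENNReal.ofReal (a ^ ρ) *
      cknE a (0 : ℝ × EuclideanSpace ℝ (Fin 3)) H ≤ (c : ℝ≥0∞) :=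
    fun a ha => le_trans (le_trans le_add_self le_self_add) (hgauge a ha)
  have hD : ∀ a : ℝ, 0 < a → ENNReal.ofReal (a ^ (2 * ρ)) *
      cknD a (0 : ℝ × EuclideanSpace ℝ (Fin 3)) p ≤ (c : ℝ≥0∞) :=
    fun a ha => le_trans le_add_self (hgauge a ha)
  ae_eq_zero_of_profile_eq_zero hρ.le hsw hH hgauge hu
    (profile_eq_zero_of_vorticalFastChannelC2_free hρ hρh hT₁ hTT₁ hsw.distributional hH hA hE hD hu hp hV hc₁ hB)

end Past

/-! ### The origin-centred member, one-sided channel, no growth -/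

/-- **EXACTLY SELF-SIMILAR MEMBERS WHOSE `C²` PROFILE HAS A FAR VORTICAL BERNOULLI CHANNEL (ONE-SIDED, `c₁ > 1/((2+ρ)(1+ρ))`) ARE TRIVIAL — NO GROWTH HYPOTHESIS,
NO UPPER RATE, NO PRESSURE CLAUSE** (crux hypotheses verbatim, `0 < ρ ≤ ½`, `γ = 1/(2+ρ)`; exact self-similarity about the origin; `V ∈ C²`; for every classical
pressure `P′` and every level `h` a radius beyond which every VORTICAL point of `{ℋ_{P′} > h}` has `⟪y, γy + V y⟫ ≤ −c₁‖y‖²`).  = the LEAD's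
`Loc.selfSimilar_ae_eq_zero_of_vorticalFastChannelC2_profile_sharp` (p639458) with the binder `hK₁` DELETED (the past member at `T = T₁ = 0`, `x₀ = 0`).
[folklore; GNS inequality] -/
theorem Loc.selfSimilar_ae_eq_zero_of_vorticalFastChannelC2_profile_free {ρ : ℝ} (hρ : 0 < ρ) (hρ1 : ρ ≤ 1 / 2)
    {u : ℝ → EuclideanSpace ℝ (Fin 3) → EuclideanSpace ℝ (Fin 3)} {p : ℝ → EuclideanSpace ℝ (Fin 3) → ℝ}
    {H : ℝ → EuclideanSpace ℝ (Fin 3) → EuclideanSpace ℝ (Fin 3) →L[ℝ] EuclideanSpace ℝ (Fin 3)} {c : ℝ≥0}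
    (hsw : IsSuitableWeakSolutionOn (slab (EuclideanSpace ℝ (Fin 3)) (Iio 0) isOpen_Iio) 0 0 u p)
    (hH : HasWeakSpatialGradientOn (slab (EuclideanSpace ℝ (Fin 3)) (Iio 0) isOpen_Iio) u H)
    (hgauge : ∀ a : ℝ, 0 < a →
      ENNReal.ofReal (a ^ (2 * ρ)) * cknA a (0 : ℝ × EuclideanSpace ℝ (Fin 3)) u +
          ENNReal.ofReal (a ^ ρ) * cknE a (0 : ℝ × EuclideanSpace ℝ (Fin 3)) H +
        ENNReal.ofReal (a ^ (2 * ρ)) * cknD a (0 : ℝ × EuclideanSpace ℝ (Fin 3)) p ≤ (c : ℝ≥0∞))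
    {V : EuclideanSpace ℝ (Fin 3) → EuclideanSpace ℝ (Fin 3)} {P : EuclideanSpace ℝ (Fin 3) → ℝ}
    (hu : ∀ τ : ℝ, τ < 0 → u τ = selfSimilarCollapse (1 / (2 + ρ)) 0 V τ)
    (hp : ∀ τ : ℝ, τ < 0 → p τ = selfSimilarCollapsePressure (1 / (2 + ρ)) 0 P τ)
    (hV : ContDiff ℝ 2 V) {c₁ : ℝ} (hc₁ : 1 / ((2 + ρ) * (1 + ρ)) < c₁)
    (hB : ∀ P' : EuclideanSpace ℝ (Fin 3) → ℝ, IsSelfSimilarEulerProfile (1 / (2 + ρ)) 0 V P' →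
      ∀ h : ℝ, ∃ R₀ : ℝ, ∀ y : EuclideanSpace ℝ (Fin 3), R₀ ≤ ‖y‖ →
        h < selfSimilarBernoulli (1 / (2 + ρ)) 0 V P' y → curl V y ≠ 0 →
          ⟪y, selfSimilarTransport (1 / (2 + ρ)) 0 V y⟫ ≤ -(c₁ * ‖y‖ ^ 2)) :
    uncurry u =ᵐ[volume.restrict (Iio (0 : ℝ) ×ˢ (univ : Set (EuclideanSpace ℝ (Fin 3))))] 0 := by
  have hu' : ∀ τ : ℝ, τ < 0 → u τ = fun x => selfSimilarCollapse (1 / (2 + ρ)) 0 V τ (x - 0) := by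
    intro τ hτ; rw [hu τ hτ]; funext x; rw [sub_zero]
  have hp' : ∀ τ : ℝ, τ < 0 → p τ = fun x => selfSimilarCollapsePressure (1 / (2 + ρ)) 0 P τ (x - 0) := by
    intro τ hτ; rw [hp τ hτ]; funext x; rw [sub_zero]
  exact Past.selfSimilar_ae_eq_zero_of_vorticalFastChannelC2_profile_free_past hρ hρ1 le_rfl le_rfl 0 hsw hH hgauge hu' hp' hV hc₁ hB

end Summit.NavierStokesRegularity.NavierStokesRegularity.Theorems.PowerGaugeEulerLiouville

end
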